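import Literature.RingTheory.TightClosure.TightClosure

/-!
# Frobenius roots of ideals (Blickle–Mustaţă–Smith `I^{[1/q]}`)

Topic: `Literature/RingTheory/TightClosure` (companion of `frobeniusPower q I = I^[q]` in
`TightClosure.lean`). For an ideal `I` of a commutative ring `R` and `q = p^e`, Blickle–Mustaţă–Smith
define, for `R` regular and `F`-finite, `I^{[1/q]}` as the SMALLEST ideal `J` with `I ⊆ J^{[q]}`
(Def. 2.2: "Let `R` be a regular, `F`-finite ring and `I ⊆ R` an ideal. … `I^{[1/q]}` is the unique
smallest ideal `J` such that `I ⊆ J^{[q]}`"; existence because on a regular `F`-finite ring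
`J ↦ J^{[q]}` commutes with arbitrary intersections, the Frobenius being flat — their Lemma 2.1 and the
discussion after Def. 2.2). Over a free basis `e₁, …, e_N` of `R` over `R^q` one has the explicit
description `(f)^{[1/q]} = (f₁, …, f_N)` where `f = Σ fᵢ^q eᵢ` (Prop. 2.5), independent of the basis;
roots commute with localisation and completion (Lemma 2.7).

We record the CHOICE-FREE definition, meaningful in every commutative ring:

* `frobeniusRoot q I := sInf {J | I ≤ frobeniusPower q J}` — the infimum of all ideals whose `q`-th
  Frobenius power contains `I` (equal to BMS's `I^{[1/q]}` whenever a smallest such ideal exists, in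
  particular for `R` regular `F`-finite);
* the Galois-connection-style API that needs no hypothesis: `frobeniusRoot_le` (any `J` with
  `I ≤ J^[q]` bounds the root from above), `frobeniusRoot_mono`, `frobeniusRoot_frobeniusPower_le`
  (`(I^[q])^{[1/q]} ≤ I`), `frobeniusRoot_top`, and — under the hypothesis that `J ↦ J^[q]` commutes
  with the infimum in question (BMS Lemma 2.1 for regular `F`-finite rings; here an explicit
  hypothesis `FrobeniusPowerInfCommutes`) — `le_frobeniusPower_frobeniusRoot` (`I ≤ (I^{[1/q]})^{[q]}`,
  i.e. the infimum is attained) and the adjunction `frobeniusRoot_le_iff`.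

Deliberately NOT here: the flatness of Frobenius on regular rings (Kunz) that discharges
`FrobeniusPowerInfCommutes`, the free-basis description (Prop. 2.5) and the behaviour under
localisation / completion / smooth base change (Lemma 2.7) — each a theorem to be proved in its own
file. Consumers: the contact tower `Diff^{≤m−1}(I) + I^{[1/p]}` proposed for the characteristic-`p`
weighted resolution datum (route `ResolutionOfSingularities/WeightedInvariant`, crux
`WeightedConstruction`, idea `frobenius-root-contact-tower`), and test ideals `τ(f^{c}) = (f^{⌈cq⌉})^{[1/q]}`.

## References

* [BlickleMustataSmith2008] M. Blickle, M. Mustaţă, K. E. Smith, *Discreteness and rationality of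
  F-thresholds*, Michigan Math. J. 57 (2008) 43–61 = arXiv:math/0607660, Lemma 2.1, Def. 2.2, Prop. 2.5, Lemma 2.7.
-/

namespace Literature.RingTheory.TightClosure

variable {R : Type*} [CommRing R]

section FrobeniusRoot

/-- The **Frobenius root** `I^{[1/q]}` of an ideal (Blickle–Mustaţă–Smith): the infimum of all ideals
`J` with `I ⊆ J^{[q]}`. On a regular `F`-finite ring this infimum is attained and `I^{[1/q]}` is "the
unique smallest ideal `J` such that `I ⊆ J^{[q]}`" (Def. 2.2); in general it is the choice-free lower
envelope of that family. [cite: BlickleMustataSmith2008, Def. 2.2] -/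
def frobeniusRoot (q : ℕ) (I : Ideal R) : Ideal R :=
  sInf {J : Ideal R | I ≤ frobeniusPower q J}

/-- Unfolding of `frobeniusRoot`. [cite: BlickleMustataSmith2008, Def. 2.2] -/
theorem frobeniusRoot_def (q : ℕ) (I : Ideal R) :
    frobeniusRoot q I = sInf {J : Ideal R | I ≤ frobeniusPower q J} :=
  rfl

/-- Any ideal whose `q`-th Frobenius power contains `I` bounds the root from above:
`I ≤ J^[q] ⇒ I^{[1/q]} ≤ J`. [cite: BlickleMustataSmith2008, Def. 2.2] -/
theorem frobeniusRoot_le {q : ℕ} {I J : Ideal R} (h : I ≤ frobeniusPower q J) :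
    frobeniusRoot q I ≤ J :=
  sInf_le h

/-- The root of the unit ideal is at most… anything containing it: `⊤^{[1/q]} ≤ ⊤` and in fact the
root of ANY ideal is bounded by `⊤` (trivial); recorded in the useful form `I^{[1/q]} ≤ ⊤`. [folklore] -/
theorem frobeniusRoot_le_top (q : ℕ) (I : Ideal R) : frobeniusRoot q I ≤ ⊤ :=
  le_top

/-- The Frobenius power of the unit ideal is the unit ideal (`1 = 1^q`). [folklore] -/
theorem frobeniusPower_top (q : ℕ) : frobeniusPower q (⊤ : Ideal R) = ⊤ := by
  rw [eq_top_iff]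
  intro x _
  have h1 : (1 : R) ∈ frobeniusPower q (⊤ : Ideal R) := by
    have := pow_mem_frobeniusPower (q := q) (I := (⊤ : Ideal R)) (x := (1 : R)) Submodule.mem_top
    simpa using this
  simpa using Ideal.mul_mem_left _ x h1

/-- Frobenius roots are monotone: `I ≤ I' ⇒ I^{[1/q]} ≤ I'^{[1/q]}`.
[cite: BlickleMustataSmith2008, Lemma 2.4 (monotonicity)] -/
theorem frobeniusRoot_mono (q : ℕ) {I I' : Ideal R} (h : I ≤ I') :
    frobeniusRoot q I ≤ frobeniusRoot q I' :=
  sInf_le_sInf fun _ hJ => h.trans hJ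

/-- `(I^[q])^{[1/q]} ≤ I`: the root of a Frobenius power is contained in the original ideal.
[cite: BlickleMustataSmith2008, Lemma 2.4] -/
theorem frobeniusRoot_frobeniusPower_le (q : ℕ) (I : Ideal R) :
    frobeniusRoot q (frobeniusPower q I) ≤ I :=
  frobeniusRoot_le le_rfl

/-- The root of the zero ideal is zero (`0 ≤ J^[q]` for `J = ⊥`). [folklore] -/
theorem frobeniusRoot_bot (q : ℕ) : frobeniusRoot q (⊥ : Ideal R) = ⊥ :=
  le_bot_iff.mp (frobeniusRoot_le bot_le)

/-- **Hypothesis under which the infimum is attained**: taking `q`-th Frobenius powers commutes with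
the infimum of the family `{J | I ≤ J^[q]}`. Blickle–Mustaţă–Smith prove that on a regular `F`-finite
ring `J ↦ J^{[q]}` commutes with ARBITRARY intersections (flatness of the Frobenius, Lemma 2.1), which
gives this for every `I`. [cite: BlickleMustataSmith2008, Lemma 2.1] -/
def FrobeniusPowerInfCommutes (q : ℕ) (I : Ideal R) : Prop :=
  frobeniusPower q (sInf {J : Ideal R | I ≤ frobeniusPower q J}) =
    sInf ((frobeniusPower q) '' {J : Ideal R | I ≤ frobeniusPower q J})

/-- **The infimum is attained** when Frobenius powers commute with it: `I ≤ (I^{[1/q]})^{[q]}`, so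
`I^{[1/q]}` is then literally the smallest ideal `J` with `I ⊆ J^{[q]}` (BMS Def. 2.2 on regular
`F`-finite rings). [cite: BlickleMustataSmith2008, Def. 2.2] -/
theorem le_frobeniusPower_frobeniusRoot {q : ℕ} {I : Ideal R} (h : FrobeniusPowerInfCommutes q I) :
    I ≤ frobeniusPower q (frobeniusRoot q I) := by
  rw [frobeniusRoot, h]
  refine le_sInf ?_
  rintro _ ⟨J, hJ, rfl⟩
  exact hJ

/-- **Adjunction** (under the same hypothesis): `I^{[1/q]} ≤ J ↔ I ≤ J^{[q]}`.
[cite: BlickleMustataSmith2008, Def. 2.2] -/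
theorem frobeniusRoot_le_iff {q : ℕ} {I J : Ideal R} (h : FrobeniusPowerInfCommutes q I) :
    frobeniusRoot q I ≤ J ↔ I ≤ frobeniusPower q J :=
  ⟨fun hle => (le_frobeniusPower_frobeniusRoot h).trans (frobeniusPower_mono q hle),
   fun hle => frobeniusRoot_le hle⟩

/-- A generator-level upper bound (the easy half of BMS Prop. 2.5): if `f = Σᵢ gᵢ^q · eᵢ` for some
finite family, then `(f)^{[1/q]} ≤ (gᵢ)ᵢ` — because `f ∈ (gᵢ)^{[q]}`. Over a free basis `(eᵢ)` of `R`
over `R^q` on a regular `F`-finite ring this is an equality (Prop. 2.5, not proved here).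
[cite: BlickleMustataSmith2008, Prop. 2.5] -/
theorem frobeniusRoot_span_singleton_le_span {q : ℕ} {ι : Type*} (s : Finset ι) (g e : ι → R)
    (f : R) (hf : f = ∑ i ∈ s, g i ^ q * e i) :
    frobeniusRoot q (Ideal.span {f}) ≤ Ideal.span (Set.range g) := by
  refine frobeniusRoot_le ?_
  rw [Ideal.span_singleton_le_iff_mem, hf]
  refine Ideal.sum_mem _ fun i _ => ?_
  exact Ideal.mul_mem_right _ _ (pow_mem_frobeniusPower (Ideal.subset_span ⟨i, rfl⟩))

end FrobeniusRoot

end Literature.RingTheory.TightClosure
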